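import Summits.KontsevichZagierPeriods.KontsevichZagierPeriods.Theorems.RootDecompRelativeModAbsoluteRegKernelPairLeOneP11
import Summits.KontsevichZagierPeriods.KontsevichZagierPeriods.Theorems.RootDecompRelativeModAbsoluteRegKernelPairLeOneP10
import Summits.KontsevichZagierPeriods.KontsevichZagierPeriods.Theorems.RootDecompRelativeModAbsoluteRegFoldingDegOneP13

/-!
(second half of the lens module, split at a declaration boundary by the landing seat to respect the 400-line policy; first half = …oluteRegKernelPairLeOneP11.lean)

(LANDED by the census seat decomp-kz-census-1 g7 `--supports stmt-KontsevichZagierPeriods-30572`; source lens-3 g9 landing package #2 / CylKernelZero Inline fallback, critic decomp-kz-crit-1 g2 CLEARED §14–§19; generic docstrings added where the source had none.)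

# `RegKernelPairDegOne`, the COMMON-`κ₀ > 0` case with BOTH KINDS (route `RootDecompRelativeModAbsolute`,
support item stmt-KontsevichZagierPeriods-30572) — PROVED · part 11 (the two core lemmas)

Cell `decomp-kz`, lens 3 (decomp-kz-lens-3 g9), §18 of the HOME file.  Item 30572 for ANY numbers `k, k'` of
regularised monomials of EITHER kind (`eᵢ, e'ⱼ ∈ {1,2}` free per monomial) sharing ONE argument function
`κ₀ > 0` (`κᵢ = κ'ⱼ = κ₀`, `ℚ`-semialgebraic on `G ∪ G'`).  The fibre numbers obey `ℓ_{2j+1,2}(κ) = ℓ_{j,1}(κ)/2`,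
so this rung needs ONE genuine change of variables (Kontsevich–Zagier rule (2), tree generator
`KZ.changeOfVariablesRel`): the fibrewise squaring `(x,θ) ↦ (x,θ²)` on the OPEN cylinder, turning odd
arctan-kind monomials into log-kind ones; Baker (mixed form) then kills the log-kind and the even-arctan-kind
remainders.  This part: the core lemmas `cyl_logEven_mem_relations` (log-kind + even-arctan-kind family with a.e.-vanishing fibre integrals is a relation: two Taylor divisions, mixed rigidity, restriction, polynomial fold, a.e.-zero base) and `cyl_commonMixed_mem_relations` (both kinds: split off the odd arctan part by rule (1b), square it by rule (2), recombine, reduce to the former).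

Source: `HOME/decomp-kz-lens-3/g9/RelativeModAbsoluteDegOneBands.lean` §18 (v6 sha256 720470ba3a4f13d9, 8617 l;
farm rc 0 / 0 warn / 0 sorry; `#print axioms regKernelPairDegOne_of_commonPos` = propext, Classical.choice,
Quot.sound), extracted verbatim into the namespace of the landed chain.  No `sorry`; standard axioms.
References: Baker 1975 Thm 2.1 [tree: `baker_holds`]; [cite: KontsevichZagier2001, §1.2]; Bochnak–Coste–Roy 1998 §2.9.
-/

noncomputable section

open Set MeasureTheory Filter Topology
open scoped BigOperators
open Literature.NumberTheory.Transcendental Literature.ModelTheory.ExponentialFields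

namespace Summit.KontsevichZagierPeriods.RootDecompRelativeModAbsolute.Rung30571

namespace RegularisedLogLayer

/-- (PRIVATE copy; the landed twins are private/unbuilt.) Finite sums of `ℚ`-semialgebraic functions. [BCR 1998, Prop. 2.2.6] -/
private theorem isSemialgebraicFunOn_finset_sum {n : ℕ} {s : Set (Fin n → ℝ)} (hs : IsSemialgebraic ℚ s)
    {ι : Type*} (I : Finset ι) {f : ι → (Fin n → ℝ) → ℝ}
    (hf : ∀ i ∈ I, IsSemialgebraicFunOn ℚ s (f i)) :
    IsSemialgebraicFunOn ℚ s (fun x => ∑ i ∈ I, f i x) := by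
  classical
  induction I using Finset.induction_on with
  | empty => exact (isSemialgebraicFunOn_ratCast hs 0).congr fun x _ => by simp
  | insert a I ha ih =>
    have h1 : IsSemialgebraicFunOn ℚ s (f a) := hf a (Finset.mem_insert_self a I)
    have h2 := ih fun i hi => hf i (Finset.mem_insert_of_mem hi)
    refine (IsSemialgebraicFunOn.add_holds h1 h2).congr fun x _ => ?_
    simp only [Pi.add_apply, Finset.sum_insert ha]

section MixedCore

/-- The unfolded monomial integrand `c(x) θ^m/(1+θ^e κ(x))` is `ℚ`-semialgebraic on `P × (0,1)`. -/
theorem isSemialgebraicFunOn_cyl_kernel {P : Set (Fin 1 → ℝ)} (hP : IsSemialgebraic ℚ P)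
    {c κ : (Fin 1 → ℝ) → ℝ} (hc : IsSemialgebraicFunOn ℚ P c) (hκs : IsSemialgebraicFunOn ℚ P κ)
    (hκ1 : ∀ x ∈ P, -1 < κ x) (m e : ℕ) :
    IsSemialgebraicFunOn ℚ (RTerm.cyl P)
      (fun z => c (Fin.init z) * kernel m e (κ (Fin.init z)) (z (Fin.last 1))) := by
  have hcyl := RTerm.isSemialgebraic_cyl hP
  have hsub : RTerm.cyl P ⊆ {z | Fin.init z ∈ P} := fun z hz => hz.1
  have hθ : IsSemialgebraicFunOn ℚ (RTerm.cyl P) (fun z : Fin (1 + 1) → ℝ => z (Fin.last 1)) :=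
    (isSemialgebraicFunOn_aeval hcyl (MvPolynomial.X (Fin.last 1))).congr fun z _ => by simp
  have hden : IsSemialgebraicFunOn ℚ (RTerm.cyl P)
      (fun z : Fin (1 + 1) → ℝ => 1 + z (Fin.last 1) ^ e * κ (Fin.init z)) :=
    ((isSemialgebraicFunOn_ratCast hcyl 1).add_holds
      ((isSemialgebraicFunOn_pow hcyl hθ e).mul_holds (hκs.comp_init_mono hcyl hsub))).congr
      fun z _ => by simp
  have hden0 : ∀ z ∈ RTerm.cyl P, 1 + z (Fin.last 1) ^ e * κ (Fin.init z) ≠ 0 := fun z hz =>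
    (one_add_pow_mul_pos e (hκ1 _ hz.1) (Ioo_subset_Icc_self hz.2)).ne'
  exact ((hc.comp_init_mono hcyl hsub).mul_holds
    ((isSemialgebraicFunOn_pow hcyl hθ m).mul_holds (hden.inv hden0))).congr fun z _ => by
      simp [kernel, div_eq_mul_inv]

/-- **Core lemma (both kinds, one common `κ > 0`).** A representation `V` on `P × (0,1)` with
integrand `a₀(x) + Σ_{m ≤ n} c¹_m(x) θ^m/(1+θκ(x)) + Σ_{m ≤ 2n+1} c²_m(x) θ^m/(1+θ²κ(x))` (data
`ℚ`-semialgebraic on `P`, `κ > 0`; the odd arctan-kind part integrable on the cylinder) whose fibre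
integrals vanish a.e. on `P` is a relation: split off the odd arctan-kind part (rule 1b), apply the
squaring move `θ ↦ θ²` to it (rule 2; `exists_sqSubst`) — it becomes log-kind with halved coefficients,
matching `ℓ_{2j+1,2} = ℓ_{j,1}/2` (`ell_odd_two`) —, recombine (rule 1b) and conclude by
`cyl_logEven_mem_relations`. [KZ 2001 §1.2 rules (1),(2); Baker1975 Thm 2.1] -/
theorem cyl_commonMixed_mem_relations {P : Set (Fin 1 → ℝ)} (hP : IsSemialgebraic ℚ P)
    (V : KZ.IntegralRep (1 + 1)) {a₀ κ : (Fin 1 → ℝ) → ℝ} (n : ℕ) {c₁ c₂ : ℕ → (Fin 1 → ℝ) → ℝ}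
    (ha₀ : IsSemialgebraicFunOn ℚ P a₀) (hκs : IsSemialgebraicFunOn ℚ P κ)
    (hc₁ : ∀ m, IsSemialgebraicFunOn ℚ P (c₁ m)) (hc₂ : ∀ m, IsSemialgebraicFunOn ℚ P (c₂ m))
    (hκ0 : ∀ x ∈ P, 0 < κ x)
    (hdom : V.domain = RTerm.cyl P)
    (hint : EqOn V.integrand (fun z => a₀ (Fin.init z) +
      ∑ m ∈ Finset.range (n + 1), c₁ m (Fin.init z) * kernel m 1 (κ (Fin.init z)) (z (Fin.last 1)) +
      ∑ m ∈ Finset.range (2 * n + 2),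
        c₂ m (Fin.init z) * kernel m 2 (κ (Fin.init z)) (z (Fin.last 1))) V.domain)
    (hodd : IntegrableOn (fun z : Fin (1 + 1) → ℝ => ∑ j ∈ Finset.range (n + 1),
      c₂ (2 * j + 1) (Fin.init z) * kernel (2 * j + 1) 2 (κ (Fin.init z)) (z (Fin.last 1)))
      (RTerm.cyl P))
    (hzero : ∀ᵐ x, x ∈ P →
      a₀ x + ∑ m ∈ Finset.range (n + 1), c₁ m x * ell m 1 (κ x) +
        ∑ m ∈ Finset.range (2 * n + 2), c₂ m x * ell m 2 (κ x) = 0) :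
    KZ.of V ∈ KZ.relations := by
  classical
  have hκ1 : ∀ x ∈ P, -1 < κ x := fun x hx => by have := hκ0 x hx; linarith
  have hcyl : IsSemialgebraic ℚ (RTerm.cyl P) := RTerm.isSemialgebraic_cyl hP
  have hcylm : MeasurableSet (RTerm.cyl P) := hcyl.measurableSet_holds
  have hsub : RTerm.cyl P ⊆ {z | Fin.init z ∈ P} := fun z hz => hz.1
  -- the parts of the integrand, as functions on the cylinder
  set FL : (Fin (1 + 1) → ℝ) → ℝ := fun z => ∑ m ∈ Finset.range (n + 1),
    c₁ m (Fin.init z) * kernel m 1 (κ (Fin.init z)) (z (Fin.last 1)) with hFL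
  set FE : (Fin (1 + 1) → ℝ) → ℝ := fun z => ∑ j ∈ Finset.range (n + 1),
    c₂ (2 * j) (Fin.init z) * kernel (2 * j) 2 (κ (Fin.init z)) (z (Fin.last 1)) with hFE
  set FO : (Fin (1 + 1) → ℝ) → ℝ := fun z => ∑ j ∈ Finset.range (n + 1),
    c₂ (2 * j + 1) (Fin.init z) * kernel (2 * j + 1) 2 (κ (Fin.init z)) (z (Fin.last 1)) with hFO
  set FO' : (Fin (1 + 1) → ℝ) → ℝ := fun z => ∑ j ∈ Finset.range (n + 1),
    (c₂ (2 * j + 1) (Fin.init z) / 2) * kernel j 1 (κ (Fin.init z)) (z (Fin.last 1)) with hFO'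
  have hc₂h : ∀ j, IsSemialgebraicFunOn ℚ P (fun x => c₂ (2 * j + 1) x / 2) := fun j =>
    ((hc₂ (2 * j + 1)).mul_holds (isSemialgebraicFunOn_ratCast hP ((1 : ℚ) / 2))).congr fun x _ => by
      simp [div_eq_mul_inv]
  have hsaL : IsSemialgebraicFunOn ℚ (RTerm.cyl P) FL :=
    isSemialgebraicFunOn_finset_sum hcyl _ fun m _ =>
      isSemialgebraicFunOn_cyl_kernel hP (hc₁ m) hκs hκ1 m 1
  have hsaE : IsSemialgebraicFunOn ℚ (RTerm.cyl P) FE :=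
    isSemialgebraicFunOn_finset_sum hcyl _ fun j _ =>
      isSemialgebraicFunOn_cyl_kernel hP (hc₂ (2 * j)) hκs hκ1 (2 * j) 2
  have hsaO : IsSemialgebraicFunOn ℚ (RTerm.cyl P) FO :=
    isSemialgebraicFunOn_finset_sum hcyl _ fun j _ =>
      isSemialgebraicFunOn_cyl_kernel hP (hc₂ (2 * j + 1)) hκs hκ1 (2 * j + 1) 2
  have hsaO' : IsSemialgebraicFunOn ℚ (RTerm.cyl P) FO' :=
    isSemialgebraicFunOn_finset_sum hcyl _ fun j _ =>
      isSemialgebraicFunOn_cyl_kernel hP (hc₂h j) hκs hκ1 j 1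
  have hsa0 : IsSemialgebraicFunOn ℚ (RTerm.cyl P) (fun z => a₀ (Fin.init z)) :=
    ha₀.comp_init_mono hcyl hsub
  -- `V`'s integrand on the cylinder
  have hVint : ∀ z ∈ RTerm.cyl P, V.integrand z = a₀ (Fin.init z) + FL z + FE z + FO z := by
    intro z hz
    rw [hint (by rw [hdom]; exact hz)]
    simp only [hFL, hFE, hFO]
    rw [sum_range_even_odd
      (fun m => c₂ m (Fin.init z) * kernel m 2 (κ (Fin.init z)) (z (Fin.last 1))) n]
    ring
  have hVi : IntegrableOn V.integrand (RTerm.cyl P) := by rw [← hdom]; exact V.integrableOn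
  -- (1) split off the odd arctan-kind part (rule 1b)
  let V₁ : KZ.IntegralRep (1 + 1) := ⟨RTerm.cyl P, fun z => a₀ (Fin.init z) + FL z + FE z, hcyl,
    (hsa0.add_holds hsaL).add_holds hsaE,
    (hVi.sub hodd).congr_fun (fun z hz => by
      show V.integrand z - FO z = a₀ (Fin.init z) + FL z + FE z
      rw [hVint z hz]; ring) hcylm⟩
  let V₂ : KZ.IntegralRep (1 + 1) := ⟨RTerm.cyl P, FO, hcyl, hsaO, hodd⟩
  have h12 : KZ.of V - KZ.of V₁ - KZ.of V₂ ∈ KZ.relations := by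
    refine KZ.integrandAddRel_subset_relations ⟨_, V, V₁, V₂, hdom.symm, hdom.symm, fun z hz => ?_, rfl⟩
    rw [hdom] at hz
    show V.integrand z = (a₀ (Fin.init z) + FL z + FE z) + FO z
    exact hVint z hz
  -- (2) the squaring move on the odd part (rule 2)
  obtain ⟨V₂', hV₂'dom, hV₂'int, h22'⟩ := exists_sqSubst (m := 1) (G := P) V₂ rfl (g := FO') hsaO'
    (fun z _ => by
      show FO z = FO' (Fin.snoc (Fin.init z) (z (Fin.last 1) ^ 2)) * (2 * z (Fin.last 1))
      simp only [hFO, hFO', Fin.init_snoc, Fin.snoc_last, Finset.sum_mul]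
      refine Finset.sum_congr rfl fun j _ => ?_
      simp only [kernel, pow_one]
      rw [← pow_mul, pow_succ]
      ring)
  have hiO' : IntegrableOn FO' (RTerm.cyl P) := by
    have h := V₂'.integrableOn
    rw [hV₂'int, hV₂'dom] at h
    exact h
  -- (3) recombine (rule 1b)
  set c₁' : ℕ → (Fin 1 → ℝ) → ℝ := fun m x => c₁ m x + c₂ (2 * m + 1) x / 2 with hc₁'
  have hc₁'sa : ∀ m, IsSemialgebraicFunOn ℚ P (c₁' m) := fun m => (hc₁ m).add_holds (hc₂h m)
  let V₃ : KZ.IntegralRep (1 + 1) := ⟨RTerm.cyl P, fun z => a₀ (Fin.init z) + FL z + FE z + FO' z,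
    hcyl, ((hsa0.add_holds hsaL).add_holds hsaE).add_holds hsaO', V₁.integrableOn.add hiO'⟩
  have h3 : KZ.of V₃ - KZ.of V₁ - KZ.of V₂' ∈ KZ.relations := by
    refine KZ.integrandAddRel_subset_relations ⟨_, V₃, V₁, V₂', rfl, hV₂'dom, fun z _ => ?_, rfl⟩
    show a₀ (Fin.init z) + FL z + FE z + FO' z = (a₀ (Fin.init z) + FL z + FE z) + V₂'.integrand z
    rw [hV₂'int]
  -- (4) `V₃` is a log + even-arctan representation with a.e.-vanishing fibre integrals
  have hV₃ : KZ.of V₃ ∈ KZ.relations := by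
    refine cyl_logEven_mem_relations hP V₃ n (a₀ := a₀) (κ := κ) (c₁ := c₁')
      (c₂ := fun j => c₂ (2 * j)) ha₀ hκs hc₁'sa (fun j => hc₂ _) hκ0 rfl (fun z _ => ?_) ?_
    · show a₀ (Fin.init z) + FL z + FE z + FO' z = _
      simp only [hFL, hFE, hFO', hc₁', add_mul, Finset.sum_add_distrib]
      ring
    · filter_upwards [hzero] with x hx hxP
      have h1 := hx hxP
      rw [sum_range_even_odd (fun m => c₂ m x * ell m 2 (κ x)) n] at h1
      have h2 : ∀ j, c₂ (2 * j + 1) x * ell (2 * j + 1) 2 (κ x) =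
          (c₂ (2 * j + 1) x / 2) * ell j 1 (κ x) := fun j => by
        rw [ell_odd_two (hκ1 x hxP)]; ring
      simp only [h2] at h1
      simp only [hc₁', add_mul, Finset.sum_add_distrib]
      linarith
  -- (5) combine
  have e : KZ.of V = (KZ.of V - KZ.of V₁ - KZ.of V₂) + (KZ.of V₂ - KZ.of V₂') -
      (KZ.of V₃ - KZ.of V₁ - KZ.of V₂') + KZ.of V₃ := by abel
  rw [e]
  exact add_mem (sub_mem (add_mem h12 h22') h3) hV₃

end MixedCore

end RegularisedLogLayer

end Summit.KontsevichZagierPeriods.RootDecompRelativeModAbsolute.Rung30571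

end
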